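import Summits.Langlands.Langlands.Theorems.CoreAdequacySplit
import Summits.Langlands.Langlands.Theorems.OdlyzkoWorldSplitAutomorphyLiftingOfSlopesplit
import Summits.Langlands.Langlands.Theorems.BrightMateBypassCert

/-!
# CoreAdequacySplit — PART 2 of 2 (kernel): §4 KERNEL I (F† ⟺ AIL ∧ SBL ∧ RSL mod the carve kit), §5 ROOT deciding theorems
(`closes` → `_root_.Langlands`, `closes_framed`), §6 NECESSITY (`Cert.*`), §3b the child-route one-liners and `closes_inline`.
Tree twin of the lens-5-g11 node `CoreAdequacySplit` v2 on F† = `OdlyzkoWorldSplit.IrreducibleSmallPrimeLifting` (stmt-Langlands-33907);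
PART 1 = `Theorems/CoreAdequacySplit.lean` (perfect core, dials, cells).  Texts byte-identical to nodes/lens-5-g11-CoreAdequacySplit.lean
(sha256 dc824d0814a0…); crit-1 CLEARED (CRITIC-LEDGER row 184).  Census-1 g18, STEP T of the lens RUNME.
-/


set_option linter.dupNamespace false

namespace Summit.Langlands.Langlands.Theorems.CoreAdequacy

open Filter
open scoped MatrixGroups
open Literature.NumberTheory.GaloisRepresentations
open Summit.Langlands.Langlands.Theses

section Cells

/-! ## §4 KERNEL I — F† ⟺ AIL ∧ SBL ∧ RSL (two excluded middles on the dials + the R1 carve, modulo the carve kit) -/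

/-- The three dial regions partition every F†-instance (ADQ | ¬ADQ ∧ SADQ | ¬ADQ ∧ ¬SADQ). -/
theorem dial_trichotomy {K : Type} [Field K] [NumberField K] {ℓ : ℕ} [Fact ℓ.Prime] {n : ℕ} (ρ : FramedGaloisRep K (PadicAlgCl ℓ) n) :
    AdequateCyclotomicImage ρ ∨ (¬ AdequateCyclotomicImage ρ ∧ SolvablyAdequateImage ρ) ∨ (¬ AdequateCyclotomicImage ρ ∧ ¬ SolvablyAdequateImage ρ) := by
  by_cases hA : AdequateCyclotomicImage ρ
  · exact Or.inl hA
  by_cases hC : SolvablyAdequateImage ρ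
  · exact Or.inr (Or.inl ⟨hA, hC⟩)
  · exact Or.inr (Or.inr ⟨hA, hC⟩)

/-- … and the regions are pairwise disjoint (the cells double-count nothing). -/
theorem dial_regions_disjoint {K : Type} [Field K] [NumberField K] {ℓ : ℕ} [Fact ℓ.Prime] {n : ℕ} (ρ : FramedGaloisRep K (PadicAlgCl ℓ) n) :
    ¬ (AdequateCyclotomicImage ρ ∧ (¬ AdequateCyclotomicImage ρ ∧ SolvablyAdequateImage ρ)) ∧
    ¬ (AdequateCyclotomicImage ρ ∧ (¬ AdequateCyclotomicImage ρ ∧ ¬ SolvablyAdequateImage ρ)) ∧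
    ¬ ((¬ AdequateCyclotomicImage ρ ∧ SolvablyAdequateImage ρ) ∧ (¬ AdequateCyclotomicImage ρ ∧ ¬ SolvablyAdequateImage ρ)) :=
  ⟨fun h => h.2.1 h.1, fun h => h.2.1 h.1, fun h => h.2.2 h.1.2⟩

/-- Both new dials REFINE the F† dial: an adequate-image / solvably-adequate instance is in particular cyclotomically irreducible. -/
theorem cycIrr_of_adequateCyclotomicImage {K : Type} [Field K] [NumberField K] {ℓ : ℕ} [Fact ℓ.Prime] {n : ℕ}
    {ρ : FramedGaloisRep K (PadicAlgCl ℓ) n} (h : AdequateCyclotomicImage ρ) : CycIrr ρ := by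
  obtain ⟨τ, hτ, hirr, _⟩ := h
  exact ⟨τ, hτ, hirr⟩

/-- A solvably-adequate instance is in particular cyclotomically irreducible (SADQ refines the F† dial). -/
theorem cycIrr_of_solvablyAdequateImage {K : Type} [Field K] [NumberField K] {ℓ : ℕ} [Fact ℓ.Prime] {n : ℕ}
    {ρ : FramedGaloisRep K (PadicAlgCl ℓ) n} (h : SolvablyAdequateImage ρ) : CycIrr ρ := by
  obtain ⟨τ, hτ, hirr, _⟩ := h
  exact ⟨τ, hτ, hirr⟩

/-- **THE CARVED CORNER OF REGION 3 IS KIT-CLOSED** (landed tree theorems of the census twin `Theorems/BrightMateBypass.lean`, BY NAME): a solvably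
reducible instance by IH(m) + Serre_w(OW, RES) + W⁺ + CSD (`Theorems.BrightMate.weakAut_of_solvablyReducible`), a solvably mated one by the bright-mate
bypass BRIGHT + Serre_w + W⁺ + A† + AUT↑ + CSD (`Theorems.BrightMate.weakAut_of_solvablyMated`).  `LiftBelow`, BRIGHT, AUT↑ of this node / of route
BrightMateBypass and of the Theorems twin agree definitionally. -/
theorem liftTail_of_carve (hOW : OdlyzkoWorldSplit.OdlyzkoWorldAutomorphy) (hRES : OdlyzkoWorldSplit.TransOdlyzkoAutomorphy)
    (hW : OdlyzkoWorldSplit.SatakeAvatarExistence) (hA : OdlyzkoWorldSplit.IrreducibleLargePrimeLifting)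
    (hB : BrightMateBypass.DensityOneCyclotomicBrightness) (hUp : BrightMateBypass.SolvableAscentConstituent)
    (hDown : HolomorphicLimitSplit.CliffordSolvableDescent)
    (K : Type) [Field K] [NumberField K] (n : ℕ) (hcpt : Literature.NumberTheory.Automorphic.isCompact_glFiniteIntegralLevel n K) (hn : 0 < n)
    (ih : LiftBelow n) (ℓ : ℕ) [Fact ℓ.Prime] (ι : PadicAlgCl ℓ ≃+* ℂ) (ρ : FramedGaloisRep K (PadicAlgCl ℓ) n)
    (h : Theorems.BrightMate.SolvablyReducible ρ ∨ Theorems.BrightMate.SolvablyMated ι ρ) : LiftTail K n hcpt ℓ ι ρ := by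
  intro hirr hgeo _
  have hS : ResidualSplit.ResidualAutomorphy := Theorems.BrightMate.serre_of_worlds hOW hRES
  have hB' : Theorems.BrightMate.DensityOneCyclotomicBrightness := hB
  have hUp' : Theorems.BrightMate.SolvableAscentConstituent := hUp
  have ih' : Theorems.BrightMate.LiftBelow n := ih
  rcases h with hsr | hsm
  · exact Theorems.BrightMate.weakAut_of_solvablyReducible hS hW hDown K n hcpt hn ih' ℓ ι ρ hirr hgeo hsr
  · exact Theorems.BrightMate.weakAut_of_solvablyMated hB' hS hW hA hUp' hDown K n hcpt hn ih' ℓ ι ρ hirr hgeo hsm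

/-- AIL ∧ SBL ∧ RSL ⟹ F† modulo the carve kit {OW, RES, W⁺, A†, BRIGHT, AUT↑, CSD} (case split on the two dials, then on the carve). -/
theorem fdagger_of_cells (h₁ : AdequateImageLifting) (h₂ : SolvablyAdequateLifting) (h₃ : NoAdequateLayerLifting)
    (hOW : OdlyzkoWorldSplit.OdlyzkoWorldAutomorphy) (hRES : OdlyzkoWorldSplit.TransOdlyzkoAutomorphy)
    (hW : OdlyzkoWorldSplit.SatakeAvatarExistence) (hA : OdlyzkoWorldSplit.IrreducibleLargePrimeLifting)
    (hB : BrightMateBypass.DensityOneCyclotomicBrightness) (hUp : BrightMateBypass.SolvableAscentConstituent)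
    (hDown : HolomorphicLimitSplit.CliffordSolvableDescent) : FDagger := by
  intro K _ _ n hcpt hn ih ℓ _ ι ρ hlt hc
  rcases dial_trichotomy ρ with hAdq | ⟨hAdq, hC⟩ | ⟨hAdq, hC⟩
  · exact h₁ K n hcpt hn ih ℓ ι ρ hlt hc hAdq
  · exact h₂ K n hcpt hn ih ℓ ι ρ hlt hc hAdq hC
  · by_cases hcv : Theorems.BrightMate.SolvablyReducible ρ ∨ Theorems.BrightMate.SolvablyMated ι ρ
    · exact liftTail_of_carve hOW hRES hW hA hB hUp hDown K n hcpt hn ih ℓ ι ρ hcv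
    · exact h₃ K n hcpt hn ih ℓ ι ρ hlt hc hAdq hC (fun h => hcv (Or.inl h)) fun h => hcv (Or.inr h)

/-- F† ⟹ each cell OUTRIGHT (each is F† on a sub-box). -/
theorem cells_of_fdagger (h : FDagger) : AdequateImageLifting ∧ SolvablyAdequateLifting ∧ NoAdequateLayerLifting :=
  ⟨fun K _ _ n hcpt hn ih ℓ _ ι ρ hlt hc _ => h K n hcpt hn ih ℓ ι ρ hlt hc,
    fun K _ _ n hcpt hn ih ℓ _ ι ρ hlt hc _ _ => h K n hcpt hn ih ℓ ι ρ hlt hc,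
    fun K _ _ n hcpt hn ih ℓ _ ι ρ hlt hc _ _ _ _ => h K n hcpt hn ih ℓ ι ρ hlt hc⟩

/-- **THE NODE: F† ⟺ AIL ∧ SBL ∧ RSL** modulo the carve kit (tree items BY NAME; 0 EQUIV — the cells are F† with extra hypotheses). -/
theorem fdagger_iff_cells (hOW : OdlyzkoWorldSplit.OdlyzkoWorldAutomorphy) (hRES : OdlyzkoWorldSplit.TransOdlyzkoAutomorphy)
    (hW : OdlyzkoWorldSplit.SatakeAvatarExistence) (hA : OdlyzkoWorldSplit.IrreducibleLargePrimeLifting)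
    (hB : BrightMateBypass.DensityOneCyclotomicBrightness) (hUp : BrightMateBypass.SolvableAscentConstituent)
    (hDown : HolomorphicLimitSplit.CliffordSolvableDescent) :
    FDagger ↔ (AdequateImageLifting ∧ SolvablyAdequateLifting ∧ NoAdequateLayerLifting) :=
  ⟨cells_of_fdagger, fun h => fdagger_of_cells h.1 h.2.1 h.2.2 hOW hRES hW hA hB hUp hDown⟩

/-- The same on the TREE decl of the target, by name. -/
theorem IrreducibleSmallPrimeLifting_iff_cells (hOW : OdlyzkoWorldSplit.OdlyzkoWorldAutomorphy) (hRES : OdlyzkoWorldSplit.TransOdlyzkoAutomorphy)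
    (hW : OdlyzkoWorldSplit.SatakeAvatarExistence) (hA : OdlyzkoWorldSplit.IrreducibleLargePrimeLifting)
    (hB : BrightMateBypass.DensityOneCyclotomicBrightness) (hUp : BrightMateBypass.SolvableAscentConstituent)
    (hDown : HolomorphicLimitSplit.CliffordSolvableDescent) :
    OdlyzkoWorldSplit.IrreducibleSmallPrimeLifting ↔ (AdequateImageLifting ∧ SolvablyAdequateLifting ∧ NoAdequateLayerLifting) :=
  fdagger_iff_tree.symm.trans (fdagger_iff_cells hOW hRES hW hA hB hUp hDown)

/-- The cells give the tree decl F† modulo the carve kit. -/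
theorem IrreducibleSmallPrimeLifting_of_coresplit (h₁ : AdequateImageLifting) (h₂ : SolvablyAdequateLifting) (h₃ : NoAdequateLayerLifting)
    (hOW : OdlyzkoWorldSplit.OdlyzkoWorldAutomorphy) (hRES : OdlyzkoWorldSplit.TransOdlyzkoAutomorphy)
    (hW : OdlyzkoWorldSplit.SatakeAvatarExistence) (hA : OdlyzkoWorldSplit.IrreducibleLargePrimeLifting)
    (hB : BrightMateBypass.DensityOneCyclotomicBrightness) (hUp : BrightMateBypass.SolvableAscentConstituent)
    (hDown : HolomorphicLimitSplit.CliffordSolvableDescent) : OdlyzkoWorldSplit.IrreducibleSmallPrimeLifting :=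
  fdagger_iff_tree.1 (fdagger_of_cells h₁ h₂ h₃ hOW hRES hW hA hB hUp hDown)

/-! ## §5 ROOT — deciding theorems concluding `_root_.Langlands` (host tree theorems BY NAME) -/

/-- SBL from the transport support and its named antecedents (W⁺, AUT↑, CSD, AIL). -/
theorem sbl_of_transport (hT : SolvableAdequacyTransport) (hW : OdlyzkoWorldSplit.SatakeAvatarExistence)
    (hUp : BrightMateBypass.SolvableAscentConstituent) (hDown : HolomorphicLimitSplit.CliffordSolvableDescent) (h₁ : AdequateImageLifting) :
    SolvablyAdequateLifting :=
  hT hW hUp hDown h₁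

/-- Lift_w from the cells, the carve kit and the host's four sibling lifting cells, through the CLOSED resplit glue (Theorems file, by name). -/
theorem liftw_of_cells (h₁ : AdequateImageLifting) (h₂ : SolvablyAdequateLifting) (h₃ : NoAdequateLayerLifting)
    (hOW : OdlyzkoWorldSplit.OdlyzkoWorldAutomorphy) (hRES : OdlyzkoWorldSplit.TransOdlyzkoAutomorphy)
    (hW : OdlyzkoWorldSplit.SatakeAvatarExistence) (hB : BrightMateBypass.DensityOneCyclotomicBrightness)
    (hUp : BrightMateBypass.SolvableAscentConstituent) (hDown : HolomorphicLimitSplit.CliffordSolvableDescent)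
    (hA : OdlyzkoWorldSplit.IrreducibleLargePrimeLifting) (hPO : OdlyzkoWorldSplit.CyclotomicReducibleOrdinaryLifting)
    (hR2 : OdlyzkoWorldSplit.CyclotomicReducibleNonOrdinaryRankTwoLifting) (hR3 : OdlyzkoWorldSplit.CyclotomicReducibleNonOrdinaryHigherRankLifting) :
    OdlyzkoWorldSplit.AutomorphyLifting :=
  Summit.Langlands.Langlands.Theorems.AutomorphyLifting_of_slopesplit_proof hA
    (IrreducibleSmallPrimeLifting_of_coresplit h₁ h₂ h₃ hOW hRES hW hA hB hUp hDown) hPO hR2 hR3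

/-- `closes` — over the HOST's tree binders (BY NAME) + the new items AIL, RSL, TRANS + BRIGHT / AUT↑ (route BrightMateBypass) + CSD (route
HolomorphicLimitSplit) + the host's A†, RPO, RNO₂, RNO₃, OW, RES, W⁺, P, L∤R, CRD (tree theorem `OdlyzkoWorldSplit.closes`); SBL is derived from TRANS. -/
theorem closes (h₁ : AdequateImageLifting) (h₃ : NoAdequateLayerLifting) (hT : SolvableAdequacyTransport)
    (hB : BrightMateBypass.DensityOneCyclotomicBrightness) (hUp : BrightMateBypass.SolvableAscentConstituent)
    (hDown : HolomorphicLimitSplit.CliffordSolvableDescent)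
    (hA : OdlyzkoWorldSplit.IrreducibleLargePrimeLifting) (hPO : OdlyzkoWorldSplit.CyclotomicReducibleOrdinaryLifting)
    (hR2 : OdlyzkoWorldSplit.CyclotomicReducibleNonOrdinaryRankTwoLifting) (hR3 : OdlyzkoWorldSplit.CyclotomicReducibleNonOrdinaryHigherRankLifting)
    (hOW : OdlyzkoWorldSplit.OdlyzkoWorldAutomorphy) (hRES : OdlyzkoWorldSplit.TransOdlyzkoAutomorphy)
    (hW : OdlyzkoWorldSplit.SatakeAvatarExistence) (hP : OdlyzkoWorldSplit.PadicMemberCompatibility)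
    (hLR : OdlyzkoWorldSplit.CompatibilityAwayFromLR) (hCRD : OdlyzkoWorldSplit.CanonicalReciprocityData) : _root_.Langlands :=
  OdlyzkoWorldSplit.closes hOW hRES
    (liftw_of_cells h₁ (sbl_of_transport hT hW hUp hDown h₁) h₃ hOW hRES hW hB hUp hDown hA hPO hR2 hR3) hW hP hLR hCRD

/-- FRAME from the host: the ten other binders + the resplit glue give «F† → Langlands». -/
theorem frame_of_host
    (hA : OdlyzkoWorldSplit.IrreducibleLargePrimeLifting) (hPO : OdlyzkoWorldSplit.CyclotomicReducibleOrdinaryLifting)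
    (hR2 : OdlyzkoWorldSplit.CyclotomicReducibleNonOrdinaryRankTwoLifting) (hR3 : OdlyzkoWorldSplit.CyclotomicReducibleNonOrdinaryHigherRankLifting)
    (hOW : OdlyzkoWorldSplit.OdlyzkoWorldAutomorphy) (hRES : OdlyzkoWorldSplit.TransOdlyzkoAutomorphy)
    (hW : OdlyzkoWorldSplit.SatakeAvatarExistence) (hP : OdlyzkoWorldSplit.PadicMemberCompatibility)
    (hLR : OdlyzkoWorldSplit.CompatibilityAwayFromLR) (hCRD : OdlyzkoWorldSplit.CanonicalReciprocityData) : SmallPrimeLiftingFrame :=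
  fun hF => OdlyzkoWorldSplit.closes hOW hRES (Summit.Langlands.Langlands.Theorems.AutomorphyLifting_of_slopesplit_proof hA hF hPO hR2 hR3) hW hP hLR hCRD

/-- `closes_framed` — the CHILD ROUTE's deciding theorem, 11 binders, all used: AIL, RSL (new cruxes), TRANS (new print support), FRAME, and BY NAME
the tree items W⁺ 17415, A† 33906, OW 28903, RES 28874 (host), BRIGHT 27678, AUT↑ 27679 (route BrightMateBypass), CSD 31695 (route HolomorphicLimitSplit).
The bridge cell SBL is not a binder: it is discharged by TRANS; the carved corner of region 3 by `liftTail_of_carve`. -/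
theorem closes_framed (h₁ : AdequateImageLifting) (h₃ : NoAdequateLayerLifting) (hW : OdlyzkoWorldSplit.SatakeAvatarExistence)
    (hUp : BrightMateBypass.SolvableAscentConstituent) (hDown : HolomorphicLimitSplit.CliffordSolvableDescent) (hT : SolvableAdequacyTransport)
    (hF : SmallPrimeLiftingFrame) (hOW : OdlyzkoWorldSplit.OdlyzkoWorldAutomorphy) (hRES : OdlyzkoWorldSplit.TransOdlyzkoAutomorphy)
    (hB : BrightMateBypass.DensityOneCyclotomicBrightness) (hA : OdlyzkoWorldSplit.IrreducibleLargePrimeLifting) : _root_.Langlands :=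
  hF (IrreducibleSmallPrimeLifting_of_coresplit h₁ (sbl_of_transport hT hW hUp hDown h₁) h₃ hOW hRES hW hA hB hUp hDown)

/-- `closes_cells` — the form with SBL staffed directly instead of TRANS (AIL, SBL, RSL, FRAME + the carve kit). -/
theorem closes_cells (h₁ : AdequateImageLifting) (h₂ : SolvablyAdequateLifting) (h₃ : NoAdequateLayerLifting) (hF : SmallPrimeLiftingFrame)
    (hOW : OdlyzkoWorldSplit.OdlyzkoWorldAutomorphy) (hRES : OdlyzkoWorldSplit.TransOdlyzkoAutomorphy)
    (hW : OdlyzkoWorldSplit.SatakeAvatarExistence) (hA : OdlyzkoWorldSplit.IrreducibleLargePrimeLifting)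
    (hB : BrightMateBypass.DensityOneCyclotomicBrightness) (hUp : BrightMateBypass.SolvableAscentConstituent)
    (hDown : HolomorphicLimitSplit.CliffordSolvableDescent) : _root_.Langlands :=
  hF (IrreducibleSmallPrimeLifting_of_coresplit h₁ h₂ h₃ hOW hRES hW hA hB hUp hDown)

/-! ## §6 NECESSITY — every cell is implied by `_root_.Langlands` (WEAKER, never COSTUME-by-strength) -/

namespace Cert

-- S ⟹ Lift_w is the landed census theorem `Theorems.BrightMate.Cert.liftw_of_langlands` (BrightMateBypassCert, p782064), used BY NAME below (dedup).

/-- Lift_w ⟹ F† (drop IH and the two dial hypotheses). -/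
theorem fdagger_of_liftw (h : OdlyzkoWorldSplit.AutomorphyLifting) : FDagger :=
  fun K _ _ n hcpt hn _ ℓ _ ι ρ _ _ => h K n hcpt hn ℓ ι ρ

/-- S ⟹ F†. -/
theorem fdagger_of_langlands (hS : _root_.Langlands) : FDagger := fdagger_of_liftw (Summit.Langlands.Langlands.Theorems.BrightMate.Cert.liftw_of_langlands hS)
/-- S ⟹ AIL. -/
theorem ail_of_langlands (hS : _root_.Langlands) : AdequateImageLifting := (cells_of_fdagger (fdagger_of_langlands hS)).1
/-- S ⟹ SBL. -/
theorem sbl_of_langlands (hS : _root_.Langlands) : SolvablyAdequateLifting := (cells_of_fdagger (fdagger_of_langlands hS)).2.1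
/-- S ⟹ RSL. -/
theorem rsl_of_langlands (hS : _root_.Langlands) : NoAdequateLayerLifting := (cells_of_fdagger (fdagger_of_langlands hS)).2.2
/-- S ⟹ FRAME (trivially; FRAME is support, never staffed). -/
theorem frame_of_langlands (hS : _root_.Langlands) : SmallPrimeLiftingFrame := fun _ => hS
/-- S ⟹ BRIGHT is NOT claimed (BRIGHT is a print support: Patrikis–Snowden–Wiles + Böckle–Hui); OW, RES, W⁺, A†, AUT↑, CSD are S-implied on their
home routes.  Through the cells the split loses nothing of necessity: -/
example (hB : BrightMateBypass.DensityOneCyclotomicBrightness) (hUp : BrightMateBypass.SolvableAscentConstituent)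
    (hDown : HolomorphicLimitSplit.CliffordSolvableDescent) (hOW : OdlyzkoWorldSplit.OdlyzkoWorldAutomorphy)
    (hRES : OdlyzkoWorldSplit.TransOdlyzkoAutomorphy) (hW : OdlyzkoWorldSplit.SatakeAvatarExistence)
    (hA : OdlyzkoWorldSplit.IrreducibleLargePrimeLifting) :
    _root_.Langlands → OdlyzkoWorldSplit.IrreducibleSmallPrimeLifting :=
  fun hS => IrreducibleSmallPrimeLifting_of_coresplit (ail_of_langlands hS) (sbl_of_langlands hS) (rsl_of_langlands hS) hOW hRES hW hA hB hUp hDown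

end Cert


/-! ## §3b The child-route ONE-LINERS (what the gate will render under `Theses/CoreAdequacySplit.lean`), certified IDENTICAL to the structured cells -/

/-- childroute.route.json `AdequateImageLifting` verbatim (4107 chars). -/
def AdequateImageLiftingInline : Prop :=
  ∀ (K : Type) [Field K] [NumberField K] (n : ℕ) (hcpt : Literature.NumberTheory.Automorphic.isCompact_glFiniteIntegralLevel n K), 0 < n → (∀ m : ℕ, m < n → ∀ (K : Type) [Field K] [NumberField K] (hcpt : Literature.NumberTheory.Automorphic.isCompact_glFiniteIntegralLevel m K), 0 < m → ∀ (ℓ : ℕ) [Fact ℓ.Prime] (ι : PadicAlgCl ℓ ≃+* ℂ) (ρ : Literature.NumberTheory.GaloisRepresentations.FramedGaloisRep K (PadicAlgCl ℓ) m), ρ.toGaloisRep.IsIrreducible → ((∀ᶠ v : IsDedekindDomain.HeightOneSpectrum (NumberField.RingOfIntegers K) in cofinite, ρ.IsUnramifiedAt v) ∧ ∀ (v : IsDedekindDomain.HeightOneSpectrum (NumberField.RingOfIntegers K)) (hv : ((ℓ : ℕ) : NumberField.RingOfIntegers K) ∈ v.asIdeal), (Literature.NumberTheory.PAdicHodge.fontainePstAdicCompletion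 v ℓ hv).IsDeRhamFramed (ρ.toLocal v)) → (∃ (π : Literature.NumberTheory.Automorphic.CuspidalAutomorphicRepData m K hcpt) (ρ' : Literature.NumberTheory.GaloisRepresentations.FramedGaloisRep K (PadicAlgCl ℓ) m), π.1.IsLAlgebraic ∧ ρ'.toGaloisRep.IsIrreducible ∧ (∀ᶠ v : IsDedekindDomain.HeightOneSpectrum (NumberField.RingOfIntegers K) in cofinite, SatakeFrobCompatibleAt ι π.1 ρ' v) ∧ ∀ᶠ v : IsDedekindDomain.HeightOneSpectrum (NumberField.RingOfIntegers K) in cofinite, ∃ P P' : Polynomial (Valued.v : Valuation (PadicAlgCl ℓ) NNReal).valuationSubring, ρ.HasFrobCharpolyAt v (P.map (Valued.v : Valuation (PadicAlgCl ℓ) NNReal).valuationSubring.subtype) ∧ ρ'.HasFrobCharpolyAt v (P'.map (Valued.v : Valuation (PadicAlgCl ℓ) NNReal).valuationSubring.subtype) ∧ P.map (IsLocalRing.residue (Valued.v : Valuation (PadicAlgCl ℓ) NNReal).valuationSubring) = P'.map (IsLocalRing.residue (Valued.v : Valuation (PadicAlgCl ℓ) NNReal).valuationSubring)) → ∃ π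 : Literature.NumberTheory.Automorphic.CuspidalAutomorphicRepData m K hcpt, π.1.IsLAlgebraic ∧ ∀ᶠ v : IsDedekindDomain.HeightOneSpectrum (NumberField.RingOfIntegers K) in cofinite, SatakeFrobCompatibleAt ι π.1 ρ v) → ∀ (ℓ : ℕ) [Fact ℓ.Prime] (ι : PadicAlgCl ℓ ≃+* ℂ) (ρ : Literature.NumberTheory.GaloisRepresentations.FramedGaloisRep K (PadicAlgCl ℓ) n), ℓ < 2 * (n + 1) → (ρ.restrictField (CyclotomicField ℓ K)).IsResiduallyAbsIrreducible → (∃ τ : Field.absoluteGaloisGroup (CyclotomicField ℓ K) →* Matrix.GeneralLinearGroup (Fin n) (Literature.NumberTheory.GaloisRepresentations.padicAlgClResidueField ℓ), (ρ.restrictField (CyclotomicField ℓ K)).IsReductionOf (RingHom.id (Literature.NumberTheory.GaloisRepresentations.padicAlgClResidueField ℓ)) τ ∧ Literature.NumberTheory.GaloisRepresentations.IsAbsIrreducible τ ∧ Literature.NumberTheory.GaloisRepresentations.Subgroup.IsThorneAdequate τ.range) → ρ.toGaloisRep.IsIrreducible → ((∀ᶠ v : IsDedekindDomain.HeightOneSpectrum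 (NumberField.RingOfIntegers K) in cofinite, ρ.IsUnramifiedAt v) ∧ ∀ (v : IsDedekindDomain.HeightOneSpectrum (NumberField.RingOfIntegers K)) (hv : ((ℓ : ℕ) : NumberField.RingOfIntegers K) ∈ v.asIdeal), (Literature.NumberTheory.PAdicHodge.fontainePstAdicCompletion v ℓ hv).IsDeRhamFramed (ρ.toLocal v)) → (∃ (π : Literature.NumberTheory.Automorphic.CuspidalAutomorphicRepData n K hcpt) (ρ' : Literature.NumberTheory.GaloisRepresentations.FramedGaloisRep K (PadicAlgCl ℓ) n), π.1.IsLAlgebraic ∧ ρ'.toGaloisRep.IsIrreducible ∧ (∀ᶠ v : IsDedekindDomain.HeightOneSpectrum (NumberField.RingOfIntegers K) in cofinite, SatakeFrobCompatibleAt ι π.1 ρ' v) ∧ ∀ᶠ v : IsDedekindDomain.HeightOneSpectrum (NumberField.RingOfIntegers K) in cofinite, ∃ P P' : Polynomial (Valued.v : Valuation (PadicAlgCl ℓ) NNReal).valuationSubring, ρ.HasFrobCharpolyAt v (P.map (Valued.v : Valuation (PadicAlgCl ℓ) NNReal).valuationSubring.subtype) ∧ ρ'.HasFrobCharpolyAt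 v (P'.map (Valued.v : Valuation (PadicAlgCl ℓ) NNReal).valuationSubring.subtype) ∧ P.map (IsLocalRing.residue (Valued.v : Valuation (PadicAlgCl ℓ) NNReal).valuationSubring) = P'.map (IsLocalRing.residue (Valued.v : Valuation (PadicAlgCl ℓ) NNReal).valuationSubring)) → ∃ π : Literature.NumberTheory.Automorphic.CuspidalAutomorphicRepData n K hcpt, π.1.IsLAlgebraic ∧ ∀ᶠ v : IsDedekindDomain.HeightOneSpectrum (NumberField.RingOfIntegers K) in cofinite, SatakeFrobCompatibleAt ι π.1 ρ v

/-- childroute.route.json `SolvablyAdequateLifting` verbatim (4976 chars). -/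
def SolvablyAdequateLiftingInline : Prop :=
  ∀ (K : Type) [Field K] [NumberField K] (n : ℕ) (hcpt : Literature.NumberTheory.Automorphic.isCompact_glFiniteIntegralLevel n K), 0 < n → (∀ m : ℕ, m < n → ∀ (K : Type) [Field K] [NumberField K] (hcpt : Literature.NumberTheory.Automorphic.isCompact_glFiniteIntegralLevel m K), 0 < m → ∀ (ℓ : ℕ) [Fact ℓ.Prime] (ι : PadicAlgCl ℓ ≃+* ℂ) (ρ : Literature.NumberTheory.GaloisRepresentations.FramedGaloisRep K (PadicAlgCl ℓ) m), ρ.toGaloisRep.IsIrreducible → ((∀ᶠ v : IsDedekindDomain.HeightOneSpectrum (NumberField.RingOfIntegers K) in cofinite, ρ.IsUnramifiedAt v) ∧ ∀ (v : IsDedekindDomain.HeightOneSpectrum (NumberField.RingOfIntegers K)) (hv : ((ℓ : ℕ) : NumberField.RingOfIntegers K) ∈ v.asIdeal), (Literature.NumberTheory.PAdicHodge.fontainePstAdicCompletion v ℓ hv).IsDeRhamFramed (ρ.toLocal v)) → (∃ (π : Literature.NumberTheory.Automorphic.CuspidalAutomorphicRepData m K hcpt) (ρ' : Literature.NumberTheory.GaloisRepresentations.FramedGaloisRep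 K (PadicAlgCl ℓ) m), π.1.IsLAlgebraic ∧ ρ'.toGaloisRep.IsIrreducible ∧ (∀ᶠ v : IsDedekindDomain.HeightOneSpectrum (NumberField.RingOfIntegers K) in cofinite, SatakeFrobCompatibleAt ι π.1 ρ' v) ∧ ∀ᶠ v : IsDedekindDomain.HeightOneSpectrum (NumberField.RingOfIntegers K) in cofinite, ∃ P P' : Polynomial (Valued.v : Valuation (PadicAlgCl ℓ) NNReal).valuationSubring, ρ.HasFrobCharpolyAt v (P.map (Valued.v : Valuation (PadicAlgCl ℓ) NNReal).valuationSubring.subtype) ∧ ρ'.HasFrobCharpolyAt v (P'.map (Valued.v : Valuation (PadicAlgCl ℓ) NNReal).valuationSubring.subtype) ∧ P.map (IsLocalRing.residue (Valued.v : Valuation (PadicAlgCl ℓ) NNReal).valuationSubring) = P'.map (IsLocalRing.residue (Valued.v : Valuation (PadicAlgCl ℓ) NNReal).valuationSubring)) → ∃ π : Literature.NumberTheory.Automorphic.CuspidalAutomorphicRepData m K hcpt, π.1.IsLAlgebraic ∧ ∀ᶠ v : IsDedekindDomain.HeightOneSpectrum (NumberField.RingOfIntegers K) in cofinite, SatakeFrobCompatibleAt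 ι π.1 ρ v) → ∀ (ℓ : ℕ) [Fact ℓ.Prime] (ι : PadicAlgCl ℓ ≃+* ℂ) (ρ : Literature.NumberTheory.GaloisRepresentations.FramedGaloisRep K (PadicAlgCl ℓ) n), ℓ < 2 * (n + 1) → (ρ.restrictField (CyclotomicField ℓ K)).IsResiduallyAbsIrreducible → ¬ (∃ τ : Field.absoluteGaloisGroup (CyclotomicField ℓ K) →* Matrix.GeneralLinearGroup (Fin n) (Literature.NumberTheory.GaloisRepresentations.padicAlgClResidueField ℓ), (ρ.restrictField (CyclotomicField ℓ K)).IsReductionOf (RingHom.id (Literature.NumberTheory.GaloisRepresentations.padicAlgClResidueField ℓ)) τ ∧ Literature.NumberTheory.GaloisRepresentations.IsAbsIrreducible τ ∧ Literature.NumberTheory.GaloisRepresentations.Subgroup.IsThorneAdequate τ.range) → (∃ τ : Field.absoluteGaloisGroup (CyclotomicField ℓ K) →* Matrix.GeneralLinearGroup (Fin n) (Literature.NumberTheory.GaloisRepresentations.padicAlgClResidueField ℓ), (ρ.restrictField (CyclotomicField ℓ K)).IsReductionOf (RingHom.id (Literature.NumberTheory.GaloisRepresentations.padicAlgClResidueField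 ℓ)) τ ∧ Literature.NumberTheory.GaloisRepresentations.IsAbsIrreducible τ ∧ ∃ P J : Subgroup (Matrix.GeneralLinearGroup (Fin n) (Literature.NumberTheory.GaloisRepresentations.padicAlgClResidueField ℓ)), (P ≤ τ.range ∧ ⁅P, P⁆ = P ∧ ∀ Q : Subgroup (Matrix.GeneralLinearGroup (Fin n) (Literature.NumberTheory.GaloisRepresentations.padicAlgClResidueField ℓ)), Q ≤ τ.range → ⁅Q, Q⁆ = Q → Q ≤ P) ∧ P ≤ J ∧ J ≤ τ.range ∧ Literature.NumberTheory.GaloisRepresentations.IsAbsIrreducible J.subtype ∧ Literature.NumberTheory.GaloisRepresentations.Subgroup.IsThorneAdequate J) → ρ.toGaloisRep.IsIrreducible → ((∀ᶠ v : IsDedekindDomain.HeightOneSpectrum (NumberField.RingOfIntegers K) in cofinite, ρ.IsUnramifiedAt v) ∧ ∀ (v : IsDedekindDomain.HeightOneSpectrum (NumberField.RingOfIntegers K)) (hv : ((ℓ : ℕ) : NumberField.RingOfIntegers K) ∈ v.asIdeal), (Literature.NumberTheory.PAdicHodge.fontainePstAdicCompletion v ℓ hv).IsDeRhamFramed (ρ.toLocal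 v)) → (∃ (π : Literature.NumberTheory.Automorphic.CuspidalAutomorphicRepData n K hcpt) (ρ' : Literature.NumberTheory.GaloisRepresentations.FramedGaloisRep K (PadicAlgCl ℓ) n), π.1.IsLAlgebraic ∧ ρ'.toGaloisRep.IsIrreducible ∧ (∀ᶠ v : IsDedekindDomain.HeightOneSpectrum (NumberField.RingOfIntegers K) in cofinite, SatakeFrobCompatibleAt ι π.1 ρ' v) ∧ ∀ᶠ v : IsDedekindDomain.HeightOneSpectrum (NumberField.RingOfIntegers K) in cofinite, ∃ P P' : Polynomial (Valued.v : Valuation (PadicAlgCl ℓ) NNReal).valuationSubring, ρ.HasFrobCharpolyAt v (P.map (Valued.v : Valuation (PadicAlgCl ℓ) NNReal).valuationSubring.subtype) ∧ ρ'.HasFrobCharpolyAt v (P'.map (Valued.v : Valuation (PadicAlgCl ℓ) NNReal).valuationSubring.subtype) ∧ P.map (IsLocalRing.residue (Valued.v : Valuation (PadicAlgCl ℓ) NNReal).valuationSubring) = P'.map (IsLocalRing.residue (Valued.v : Valuation (PadicAlgCl ℓ) NNReal).valuationSubring)) → ∃ π : Literature.NumberTheory.Automorphic.CuspidalAutomorphicRepData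 n K hcpt, π.1.IsLAlgebraic ∧ ∀ᶠ v : IsDedekindDomain.HeightOneSpectrum (NumberField.RingOfIntegers K) in cofinite, SatakeFrobCompatibleAt ι π.1 ρ v

/-- childroute.route.json `NoAdequateLayerLifting` verbatim (10223 chars). -/
def NoAdequateLayerLiftingInline : Prop :=
  ∀ (K : Type) [Field K] [NumberField K] (n : ℕ) (hcpt : Literature.NumberTheory.Automorphic.isCompact_glFiniteIntegralLevel n K), 0 < n → (∀ m : ℕ, m < n → ∀ (K : Type) [Field K] [NumberField K] (hcpt : Literature.NumberTheory.Automorphic.isCompact_glFiniteIntegralLevel m K), 0 < m → ∀ (ℓ : ℕ) [Fact ℓ.Prime] (ι : PadicAlgCl ℓ ≃+* ℂ) (ρ : Literature.NumberTheory.GaloisRepresentations.FramedGaloisRep K (PadicAlgCl ℓ) m), ρ.toGaloisRep.IsIrreducible → ((∀ᶠ v : IsDedekindDomain.HeightOneSpectrum (NumberField.RingOfIntegers K) in cofinite, ρ.IsUnramifiedAt v) ∧ ∀ (v : IsDedekindDomain.HeightOneSpectrum (NumberField.RingOfIntegers K)) (hv : ((ℓ : ℕ) : NumberField.RingOfIntegers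 K) ∈ v.asIdeal), (Literature.NumberTheory.PAdicHodge.fontainePstAdicCompletion v ℓ hv).IsDeRhamFramed (ρ.toLocal v)) → (∃ (π : Literature.NumberTheory.Automorphic.CuspidalAutomorphicRepData m K hcpt) (ρ' : Literature.NumberTheory.GaloisRepresentations.FramedGaloisRep K (PadicAlgCl ℓ) m), π.1.IsLAlgebraic ∧ ρ'.toGaloisRep.IsIrreducible ∧ (∀ᶠ v : IsDedekindDomain.HeightOneSpectrum (NumberField.RingOfIntegers K) in cofinite, SatakeFrobCompatibleAt ι π.1 ρ' v) ∧ ∀ᶠ v : IsDedekindDomain.HeightOneSpectrum (NumberField.RingOfIntegers K) in cofinite, ∃ P P' : Polynomial (Valued.v : Valuation (PadicAlgCl ℓ) NNReal).valuationSubring, ρ.HasFrobCharpolyAt v (P.map (Valued.v : Valuation (PadicAlgCl ℓ) NNReal).valuationSubring.subtype) ∧ ρ'.HasFrobCharpolyAt v (P'.map (Valued.v : Valuation (PadicAlgCl ℓ) NNReal).valuationSubring.subtype) ∧ P.map (IsLocalRing.residue (Valued.v : Valuation (PadicAlgCl ℓ) NNReal).valuationSubring) = P'.map (IsLocalRing.residue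 (Valued.v : Valuation (PadicAlgCl ℓ) NNReal).valuationSubring)) → ∃ π : Literature.NumberTheory.Automorphic.CuspidalAutomorphicRepData m K hcpt, π.1.IsLAlgebraic ∧ ∀ᶠ v : IsDedekindDomain.HeightOneSpectrum (NumberField.RingOfIntegers K) in cofinite, SatakeFrobCompatibleAt ι π.1 ρ v) → ∀ (ℓ : ℕ) [Fact ℓ.Prime] (ι : PadicAlgCl ℓ ≃+* ℂ) (ρ : Literature.NumberTheory.GaloisRepresentations.FramedGaloisRep K (PadicAlgCl ℓ) n), ℓ < 2 * (n + 1) → (ρ.restrictField (CyclotomicField ℓ K)).IsResiduallyAbsIrreducible → ¬ (∃ τ : Field.absoluteGaloisGroup (CyclotomicField ℓ K) →* Matrix.GeneralLinearGroup (Fin n) (Literature.NumberTheory.GaloisRepresentations.padicAlgClResidueField ℓ), (ρ.restrictField (CyclotomicField ℓ K)).IsReductionOf (RingHom.id (Literature.NumberTheory.GaloisRepresentations.padicAlgClResidueField ℓ)) τ ∧ Literature.NumberTheory.GaloisRepresentations.IsAbsIrreducible τ ∧ Literature.NumberTheory.GaloisRepresentations.Subgroup.IsThorneAdequate τ.range)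 → ¬ (∃ τ : Field.absoluteGaloisGroup (CyclotomicField ℓ K) →* Matrix.GeneralLinearGroup (Fin n) (Literature.NumberTheory.GaloisRepresentations.padicAlgClResidueField ℓ), (ρ.restrictField (CyclotomicField ℓ K)).IsReductionOf (RingHom.id (Literature.NumberTheory.GaloisRepresentations.padicAlgClResidueField ℓ)) τ ∧ Literature.NumberTheory.GaloisRepresentations.IsAbsIrreducible τ ∧ ∃ P J : Subgroup (Matrix.GeneralLinearGroup (Fin n) (Literature.NumberTheory.GaloisRepresentations.padicAlgClResidueField ℓ)), (P ≤ τ.range ∧ ⁅P, P⁆ = P ∧ ∀ Q : Subgroup (Matrix.GeneralLinearGroup (Fin n) (Literature.NumberTheory.GaloisRepresentations.padicAlgClResidueField ℓ)), Q ≤ τ.range → ⁅Q, Q⁆ = Q → Q ≤ P) ∧ P ≤ J ∧ J ≤ τ.range ∧ Literature.NumberTheory.GaloisRepresentations.IsAbsIrreducible J.subtype ∧ Literature.NumberTheory.GaloisRepresentations.Subgroup.IsThorneAdequate J) → ¬ (∃ (E : Type) (_ : Field E) (_ : NumberField E) (_ : Algebra K E), IsGalois K E ∧ IsSolvable (E ≃ₐ[K]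 E) ∧ ∃ (m : ℕ) (ϑ : Literature.NumberTheory.GaloisRepresentations.FramedGaloisRep E (PadicAlgCl ℓ) m), m < n ∧ 0 < m ∧ ϑ.toGaloisRep.IsIrreducible ∧ ((∀ᶠ v : IsDedekindDomain.HeightOneSpectrum (NumberField.RingOfIntegers E) in cofinite, ϑ.IsUnramifiedAt v) ∧ ∀ (v : IsDedekindDomain.HeightOneSpectrum (NumberField.RingOfIntegers E)) (hv : ((ℓ : ℕ) : NumberField.RingOfIntegers E) ∈ v.asIdeal), (Literature.NumberTheory.PAdicHodge.fontainePstAdicCompletion v ℓ hv).IsDeRhamFramed (ϑ.toLocal v)) ∧ (∃ (mc : ℕ) (θc : Literature.NumberTheory.GaloisRepresentations.FramedGaloisRep E (PadicAlgCl ℓ) mc), ∀ g : Field.absoluteGaloisGroup E, Literature.NumberTheory.GaloisRepresentations.FramedRep.trace (ρ.restrictField E) g = Literature.NumberTheory.GaloisRepresentations.FramedRep.trace ϑ g + Literature.NumberTheory.GaloisRepresentations.FramedRep.trace θc g)) → ¬ ((∃ (S : Finset (IsDedekindDomain.HeightOneSpectrum (NumberField.RingOfIntegers K))) (Q : IsDedekindDomain.HeightOneSpectrum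 (NumberField.RingOfIntegers K) → Polynomial ℂ) (I : Finset ℤ) (L : Set ℕ) (r : ∀ (ℓ' : ℕ) [Fact ℓ'.Prime], (PadicAlgCl ℓ' ≃+* ℂ) → Literature.NumberTheory.GaloisRepresentations.FramedGaloisRep K (PadicAlgCl ℓ') n), ((∃ E : Subfield ℂ, FiniteDimensional ℚ E ∧ ∀ v : IsDedekindDomain.HeightOneSpectrum (NumberField.RingOfIntegers K), v ∉ S → ∀ i : ℕ, (Q v).coeff i ∈ E) ∧ Literature.NumberTheory.LFunctions.HasDirichletDensity L 1 ∧ ∀ (ℓ' : ℕ) [Fact ℓ'.Prime], ℓ' ∈ L → ∀ ι' : PadicAlgCl ℓ' ≃+* ℂ, (r ℓ' ι').toGaloisRep.IsIrreducible ∧ (∀ᶠ v : IsDedekindDomain.HeightOneSpectrum (NumberField.RingOfIntegers K) in cofinite, (r ℓ' ι').IsUnramifiedAt v) ∧ (∀ v : IsDedekindDomain.HeightOneSpectrum (NumberField.RingOfIntegers K), v ∉ S → ((ℓ' : ℕ) : NumberField.RingOfIntegers K) ∉ v.asIdeal → (r ℓ' ι').IsUnramifiedAt v ∧ (r ℓ'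 ι').HasFrobCharpolyAt v ((Q v).map (ι'.symm : ℂ ≃+* PadicAlgCl ℓ').toRingHom)) ∧ ∀ (v : IsDedekindDomain.HeightOneSpectrum (NumberField.RingOfIntegers K)) (hv : ((ℓ' : ℕ) : NumberField.RingOfIntegers K) ∈ v.asIdeal), (Literature.NumberTheory.PAdicHodge.fontainePstAdicCompletion v ℓ' hv).IsDeRhamFramed ((r ℓ' ι').toLocal v) ∧ (v ∉ S → (Literature.NumberTheory.PAdicHodge.fontainePstAdicCompletion v ℓ' hv).IsCrystallineFramed ((r ℓ' ι').toLocal v) ∧ letI := (Literature.NumberTheory.PAdicHodge.fontainePstAdicCompletion v ℓ' hv).algebra; ∀ τ : v.adicCompletion K →ₐ[ℚ_[ℓ']] PadicAlgCl ℓ', ∀ h ∈ (r ℓ' ι').labelledHodgeTateWeightsAt v (Literature.NumberTheory.PAdicHodge.fontainePstAdicCompletion v ℓ' hv).algebra (Literature.NumberTheory.PAdicHodge.fontainePstAdicCompletion v ℓ' hv).𝔅 τ.toRingHom, h ∈ I)) ∧ ∀ v : IsDedekindDomain.HeightOneSpectrum (NumberField.RingOfIntegers K), v ∉ S → ((ℓ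 : ℕ) : NumberField.RingOfIntegers K) ∉ v.asIdeal → ρ.IsUnramifiedAt v ∧ ρ.HasFrobCharpolyAt v ((Q v).map (ι.symm : ℂ ≃+* PadicAlgCl ℓ).toRingHom)) ∨ ∃ (N : Type) (_ : Field N) (_ : NumberField N) (_ : Algebra K N) (M : Type) (_ : Field M) (_ : NumberField M) (_ : Algebra K M) (_ : Algebra M N) (_ : IsScalarTower K M N), IsGalois K N ∧ IsSolvable (N ≃ₐ[K] N) ∧ (ρ.restrictField M).toGaloisRep.IsIrreducible ∧ ∃ (S : Finset (IsDedekindDomain.HeightOneSpectrum (NumberField.RingOfIntegers M))) (Q : IsDedekindDomain.HeightOneSpectrum (NumberField.RingOfIntegers M) → Polynomial ℂ) (I : Finset ℤ) (L : Set ℕ) (r : ∀ (ℓ' : ℕ) [Fact ℓ'.Prime], (PadicAlgCl ℓ' ≃+* ℂ) → Literature.NumberTheory.GaloisRepresentations.FramedGaloisRep M (PadicAlgCl ℓ') n), ((∃ E : Subfield ℂ, FiniteDimensional ℚ E ∧ ∀ v : IsDedekindDomain.HeightOneSpectrum (NumberField.RingOfIntegers M), v ∉ S → ∀ i : ℕ,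 (Q v).coeff i ∈ E) ∧ Literature.NumberTheory.LFunctions.HasDirichletDensity L 1 ∧ ∀ (ℓ' : ℕ) [Fact ℓ'.Prime], ℓ' ∈ L → ∀ ι' : PadicAlgCl ℓ' ≃+* ℂ, (r ℓ' ι').toGaloisRep.IsIrreducible ∧ (∀ᶠ v : IsDedekindDomain.HeightOneSpectrum (NumberField.RingOfIntegers M) in cofinite, (r ℓ' ι').IsUnramifiedAt v) ∧ (∀ v : IsDedekindDomain.HeightOneSpectrum (NumberField.RingOfIntegers M), v ∉ S → ((ℓ' : ℕ) : NumberField.RingOfIntegers M) ∉ v.asIdeal → (r ℓ' ι').IsUnramifiedAt v ∧ (r ℓ' ι').HasFrobCharpolyAt v ((Q v).map (ι'.symm : ℂ ≃+* PadicAlgCl ℓ').toRingHom)) ∧ ∀ (v : IsDedekindDomain.HeightOneSpectrum (NumberField.RingOfIntegers M)) (hv : ((ℓ' : ℕ) : NumberField.RingOfIntegers M) ∈ v.asIdeal), (Literature.NumberTheory.PAdicHodge.fontainePstAdicCompletion v ℓ' hv).IsDeRhamFramed ((r ℓ' ι').toLocal v) ∧ (v ∉ S → (Literature.NumberTheory.PAdicHodge.fontainePstAdicCompletion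 v ℓ' hv).IsCrystallineFramed ((r ℓ' ι').toLocal v) ∧ letI := (Literature.NumberTheory.PAdicHodge.fontainePstAdicCompletion v ℓ' hv).algebra; ∀ τ : v.adicCompletion M →ₐ[ℚ_[ℓ']] PadicAlgCl ℓ', ∀ h ∈ (r ℓ' ι').labelledHodgeTateWeightsAt v (Literature.NumberTheory.PAdicHodge.fontainePstAdicCompletion v ℓ' hv).algebra (Literature.NumberTheory.PAdicHodge.fontainePstAdicCompletion v ℓ' hv).𝔅 τ.toRingHom, h ∈ I)) ∧ ∀ v : IsDedekindDomain.HeightOneSpectrum (NumberField.RingOfIntegers M), v ∉ S → ((ℓ : ℕ) : NumberField.RingOfIntegers M) ∉ v.asIdeal → (ρ.restrictField M).IsUnramifiedAt v ∧ (ρ.restrictField M).HasFrobCharpolyAt v ((Q v).map (ι.symm : ℂ ≃+* PadicAlgCl ℓ).toRingHom)) → ρ.toGaloisRep.IsIrreducible → ((∀ᶠ v : IsDedekindDomain.HeightOneSpectrum (NumberField.RingOfIntegers K) in cofinite, ρ.IsUnramifiedAt v) ∧ ∀ (v : IsDedekindDomain.HeightOneSpectrum (NumberField.RingOfIntegers K))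 (hv : ((ℓ : ℕ) : NumberField.RingOfIntegers K) ∈ v.asIdeal), (Literature.NumberTheory.PAdicHodge.fontainePstAdicCompletion v ℓ hv).IsDeRhamFramed (ρ.toLocal v)) → (∃ (π : Literature.NumberTheory.Automorphic.CuspidalAutomorphicRepData n K hcpt) (ρ' : Literature.NumberTheory.GaloisRepresentations.FramedGaloisRep K (PadicAlgCl ℓ) n), π.1.IsLAlgebraic ∧ ρ'.toGaloisRep.IsIrreducible ∧ (∀ᶠ v : IsDedekindDomain.HeightOneSpectrum (NumberField.RingOfIntegers K) in cofinite, SatakeFrobCompatibleAt ι π.1 ρ' v) ∧ ∀ᶠ v : IsDedekindDomain.HeightOneSpectrum (NumberField.RingOfIntegers K) in cofinite, ∃ P P' : Polynomial (Valued.v : Valuation (PadicAlgCl ℓ) NNReal).valuationSubring, ρ.HasFrobCharpolyAt v (P.map (Valued.v : Valuation (PadicAlgCl ℓ) NNReal).valuationSubring.subtype) ∧ ρ'.HasFrobCharpolyAt v (P'.map (Valued.v : Valuation (PadicAlgCl ℓ) NNReal).valuationSubring.subtype) ∧ P.map (IsLocalRing.residue (Valued.v : Valuation (PadicAlgCl ℓ)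 NNReal).valuationSubring) = P'.map (IsLocalRing.residue (Valued.v : Valuation (PadicAlgCl ℓ) NNReal).valuationSubring)) → ∃ π : Literature.NumberTheory.Automorphic.CuspidalAutomorphicRepData n K hcpt, π.1.IsLAlgebraic ∧ ∀ᶠ v : IsDedekindDomain.HeightOneSpectrum (NumberField.RingOfIntegers K) in cofinite, SatakeFrobCompatibleAt ι π.1 ρ v

/-- childroute.route.json `SatakeAvatarExistence` verbatim (524 chars). -/
def SatakeAvatarExistenceInline : Prop :=
  ∀ (K : Type) [Field K] [NumberField K] (n : ℕ) (hcpt : Literature.NumberTheory.Automorphic.isCompact_glFiniteIntegralLevel n K), 0 < n → ∀ (π : Literature.NumberTheory.Automorphic.CuspidalAutomorphicRepData n K hcpt), π.1.IsLAlgebraic → ∀ (ℓ : ℕ) [Fact ℓ.Prime] (ι : PadicAlgCl ℓ ≃+* ℂ), ∃ ρ : Literature.NumberTheory.GaloisRepresentations.FramedGaloisRep K (PadicAlgCl ℓ) n, ρ.toGaloisRep.IsIrreducible ∧ ∀ᶠ v : IsDedekindDomain.HeightOneSpectrum (NumberField.RingOfIntegers K) in cofinite, SatakeFrobCompatibleAt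 ι π.1 ρ v

/-- childroute.route.json `SolvableAscentConstituent` verbatim (1958 chars). -/
def SolvableAscentConstituentInline : Prop :=
  (∀ (K : Type) [Field K] [NumberField K] (n : ℕ) (hcpt : Literature.NumberTheory.Automorphic.isCompact_glFiniteIntegralLevel n K), 0 < n → ∀ (π : Literature.NumberTheory.Automorphic.CuspidalAutomorphicRepData n K hcpt), π.1.IsLAlgebraic → ∀ (ℓ : ℕ) [Fact ℓ.Prime] (ι : PadicAlgCl ℓ ≃+* ℂ), ∃ ρ : Literature.NumberTheory.GaloisRepresentations.FramedGaloisRep K (PadicAlgCl ℓ) n, ρ.toGaloisRep.IsIrreducible ∧ ∀ᶠ v : IsDedekindDomain.HeightOneSpectrum (NumberField.RingOfIntegers K) in cofinite, SatakeFrobCompatibleAt ι π.1 ρ v) → ∀ (M : Type) [Field M] [NumberField M] (n : ℕ) (ℓ : ℕ) [Fact ℓ.Prime] (ι : PadicAlgCl ℓ ≃+* ℂ) (ρ : Literature.NumberTheory.GaloisRepresentations.FramedGaloisRep M (PadicAlgCl ℓ) n), ρ.toGaloisRep.IsIrreducible → 0 < n → (∀ hcpt : Literature.NumberTheory.Automorphic.isCompact_glFiniteIntegralLevel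 n M, ∃ π : Literature.NumberTheory.Automorphic.CuspidalAutomorphicRepData n M hcpt, π.1.IsLAlgebraic ∧ ∀ᶠ v : IsDedekindDomain.HeightOneSpectrum (NumberField.RingOfIntegers M) in Filter.cofinite, SatakeFrobCompatibleAt ι π.1 ρ v) → ∀ (N : Type) [Field N] [NumberField N] [Algebra M N], IsGalois M N → IsSolvable (N ≃ₐ[M] N) → ∃ (m : ℕ) (ϑ : Literature.NumberTheory.GaloisRepresentations.FramedGaloisRep N (PadicAlgCl ℓ) m), ϑ.toGaloisRep.IsIrreducible ∧ (∃ (mc : ℕ) (θc : Literature.NumberTheory.GaloisRepresentations.FramedGaloisRep N (PadicAlgCl ℓ) mc), ∀ g : Field.absoluteGaloisGroup N, Literature.NumberTheory.GaloisRepresentations.FramedRep.trace (ρ.restrictField N) g = Literature.NumberTheory.GaloisRepresentations.FramedRep.trace ϑ g + Literature.NumberTheory.GaloisRepresentations.FramedRep.trace θc g) ∧ 0 < m ∧ ∀ hcptN : Literature.NumberTheory.Automorphic.isCompact_glFiniteIntegralLevel m N, ∃ π : Literature.NumberTheory.Automorphic.CuspidalAutomorphicRepData m N hcptN, π.1.IsLAlgebraic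 ∧ ∀ᶠ v : IsDedekindDomain.HeightOneSpectrum (NumberField.RingOfIntegers N) in Filter.cofinite, SatakeFrobCompatibleAt ι π.1 ϑ v

/-- childroute.route.json `CliffordSolvableDescent` verbatim (2319 chars). -/
def CliffordSolvableDescentInline : Prop :=
  (∀ (K : Type) [Field K] [NumberField K] (n : ℕ) (hcpt : Literature.NumberTheory.Automorphic.isCompact_glFiniteIntegralLevel n K), 0 < n → ∀ (π : Literature.NumberTheory.Automorphic.CuspidalAutomorphicRepData n K hcpt), π.1.IsLAlgebraic → ∀ (ℓ : ℕ) [Fact ℓ.Prime] (ι : PadicAlgCl ℓ ≃+* ℂ), ∃ ρ : Literature.NumberTheory.GaloisRepresentations.FramedGaloisRep K (PadicAlgCl ℓ) n, ρ.toGaloisRep.IsIrreducible ∧ ∀ᶠ v : IsDedekindDomain.HeightOneSpectrum (NumberField.RingOfIntegers K) in Filter.cofinite, SatakeFrobCompatibleAt ι π.1 ρ v) → ∀ (K : Type) [Field K] [NumberField K] (n : ℕ) (ℓ : ℕ) [Fact ℓ.Prime] (ι : PadicAlgCl ℓ ≃+* ℂ) (ρ : Literature.NumberTheory.GaloisRepresentations.FramedGaloisRep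 K (PadicAlgCl ℓ) n), ρ.toGaloisRep.IsIrreducible → ((∀ᶠ v : IsDedekindDomain.HeightOneSpectrum (NumberField.RingOfIntegers K) in Filter.cofinite, ρ.IsUnramifiedAt v) ∧ ∀ (v : IsDedekindDomain.HeightOneSpectrum (NumberField.RingOfIntegers K)) (hv : ((ℓ : ℕ) : NumberField.RingOfIntegers K) ∈ v.asIdeal), (Literature.NumberTheory.PAdicHodge.fontainePstAdicCompletion v ℓ hv).IsDeRhamFramed (ρ.toLocal v)) → 0 < n → ∀ (E : Type) [Field E] [NumberField E] [Algebra K E], IsGalois K E → IsSolvable (E ≃ₐ[K] E) → ∀ (m : ℕ) (ϑ : Literature.NumberTheory.GaloisRepresentations.FramedGaloisRep E (PadicAlgCl ℓ) m), ϑ.toGaloisRep.IsIrreducible → (∃ (mc : ℕ) (θc : Literature.NumberTheory.GaloisRepresentations.FramedGaloisRep E (PadicAlgCl ℓ) mc), ∀ g : Field.absoluteGaloisGroup E, Literature.NumberTheory.GaloisRepresentations.FramedRep.trace (ρ.restrictField E) g = Literature.NumberTheory.GaloisRepresentations.FramedRep.trace ϑ g + Literature.NumberTheory.GaloisRepresentations.FramedRep.trace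 θc g) → 0 < m → (∀ hcptE : Literature.NumberTheory.Automorphic.isCompact_glFiniteIntegralLevel m E, ∃ π : Literature.NumberTheory.Automorphic.CuspidalAutomorphicRepData m E hcptE, π.1.IsLAlgebraic ∧ ∀ᶠ v : IsDedekindDomain.HeightOneSpectrum (NumberField.RingOfIntegers E) in Filter.cofinite, SatakeFrobCompatibleAt ι π.1 ϑ v) → ∀ hcpt : Literature.NumberTheory.Automorphic.isCompact_glFiniteIntegralLevel n K, ∃ π : Literature.NumberTheory.Automorphic.CuspidalAutomorphicRepData n K hcpt, π.1.IsLAlgebraic ∧ ∀ᶠ v : IsDedekindDomain.HeightOneSpectrum (NumberField.RingOfIntegers K) in Filter.cofinite, SatakeFrobCompatibleAt ι π.1 ρ v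

/-- childroute.route.json `SolvableAdequacyTransport` verbatim, over the INLINE items it names. -/
def SolvableAdequacyTransportInline : Prop :=
  SatakeAvatarExistenceInline → SolvableAscentConstituentInline → CliffordSolvableDescentInline → AdequateImageLiftingInline → SolvablyAdequateLiftingInline

/-- The AIL item text (route.json one-liner) is the structured cell (definitional). -/
theorem ail_inline_iff : AdequateImageLiftingInline ↔ AdequateImageLifting := Iff.rfl
/-- The SBL text (conclusion of TRANS) is the structured cell (definitional). -/
theorem sbl_inline_iff : SolvablyAdequateLiftingInline ↔ SolvablyAdequateLifting := Iff.rfl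
/-- The RSL item text (route.json one-liner) is the structured cell (definitional). -/
theorem rsl_inline_iff : NoAdequateLayerLiftingInline ↔ NoAdequateLayerLifting := Iff.rfl
/-- The W⁺ item text is the host decl `OdlyzkoWorldSplit.SatakeAvatarExistence` verbatim (dedup-attach, stmt-Langlands-17415). -/
theorem wp_inline_iff : SatakeAvatarExistenceInline ↔ OdlyzkoWorldSplit.SatakeAvatarExistence := Iff.rfl
/-- The AUT↑ item text is the tree decl `BrightMateBypass.SolvableAscentConstituent` verbatim (dedup-attach, stmt-Langlands-27679). -/
theorem autup_inline_iff : SolvableAscentConstituentInline ↔ BrightMateBypass.SolvableAscentConstituent := Iff.rfl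
/-- The SOLVRED carve clause inserted into RSL is `Theorems.BrightMate.SolvablyReducible ρ` (landed tree def; definitional). -/
theorem solvred_clause_iff (K : Type) [Field K] [NumberField K] (n : ℕ) (ℓ : ℕ) [Fact ℓ.Prime] (ρ : FramedGaloisRep K (PadicAlgCl ℓ) n) :
    (∃ (E : Type) (_ : Field E) (_ : NumberField E) (_ : Algebra K E), IsGalois K E ∧ IsSolvable (E ≃ₐ[K] E) ∧ ∃ (m : ℕ) (ϑ : Literature.NumberTheory.GaloisRepresentations.FramedGaloisRep E (PadicAlgCl ℓ) m), m < n ∧ 0 < m ∧ ϑ.toGaloisRep.IsIrreducible ∧ ((∀ᶠ v : IsDedekindDomain.HeightOneSpectrum (NumberField.RingOfIntegers E) in cofinite, ϑ.IsUnramifiedAt v) ∧ ∀ (v : IsDedekindDomain.HeightOneSpectrum (NumberField.RingOfIntegers E)) (hv : ((ℓ : ℕ) : NumberField.RingOfIntegers E) ∈ v.asIdeal), (Literature.NumberTheory.PAdicHodge.fontainePstAdicCompletion v ℓ hv).IsDeRhamFramed (ϑ.toLocal v)) ∧ (∃ (mc : ℕ) (θc : Literature.NumberTheory.GaloisRepresentations.FramedGaloisRep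 E (PadicAlgCl ℓ) mc), ∀ g : Field.absoluteGaloisGroup E, Literature.NumberTheory.GaloisRepresentations.FramedRep.trace (ρ.restrictField E) g = Literature.NumberTheory.GaloisRepresentations.FramedRep.trace ϑ g + Literature.NumberTheory.GaloisRepresentations.FramedRep.trace θc g)) ↔ Theorems.BrightMate.SolvablyReducible ρ := Iff.rfl
/-- The SOLVM carve clause inserted into RSL is `Theorems.BrightMate.SolvablyMated ι ρ` (landed tree def; definitional). -/
theorem solvm_clause_iff (K : Type) [Field K] [NumberField K] (n : ℕ) (ℓ : ℕ) [Fact ℓ.Prime] (ι : PadicAlgCl ℓ ≃+* ℂ) (ρ : FramedGaloisRep K (PadicAlgCl ℓ) n) :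
    ((∃ (S : Finset (IsDedekindDomain.HeightOneSpectrum (NumberField.RingOfIntegers K))) (Q : IsDedekindDomain.HeightOneSpectrum (NumberField.RingOfIntegers K) → Polynomial ℂ) (I : Finset ℤ) (L : Set ℕ) (r : ∀ (ℓ' : ℕ) [Fact ℓ'.Prime], (PadicAlgCl ℓ' ≃+* ℂ) → Literature.NumberTheory.GaloisRepresentations.FramedGaloisRep K (PadicAlgCl ℓ') n), ((∃ E : Subfield ℂ, FiniteDimensional ℚ E ∧ ∀ v : IsDedekindDomain.HeightOneSpectrum (NumberField.RingOfIntegers K), v ∉ S → ∀ i : ℕ, (Q v).coeff i ∈ E) ∧ Literature.NumberTheory.LFunctions.HasDirichletDensity L 1 ∧ ∀ (ℓ' : ℕ) [Fact ℓ'.Prime], ℓ' ∈ L → ∀ ι' : PadicAlgCl ℓ' ≃+* ℂ, (r ℓ' ι').toGaloisRep.IsIrreducible ∧ (∀ᶠ v : IsDedekindDomain.HeightOneSpectrum (NumberField.RingOfIntegers K) in cofinite, (r ℓ' ι').IsUnramifiedAt v) ∧ (∀ v : IsDedekindDomain.HeightOneSpectrum (NumberField.RingOfIntegers K), v ∉ S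 → ((ℓ' : ℕ) : NumberField.RingOfIntegers K) ∉ v.asIdeal → (r ℓ' ι').IsUnramifiedAt v ∧ (r ℓ' ι').HasFrobCharpolyAt v ((Q v).map (ι'.symm : ℂ ≃+* PadicAlgCl ℓ').toRingHom)) ∧ ∀ (v : IsDedekindDomain.HeightOneSpectrum (NumberField.RingOfIntegers K)) (hv : ((ℓ' : ℕ) : NumberField.RingOfIntegers K) ∈ v.asIdeal), (Literature.NumberTheory.PAdicHodge.fontainePstAdicCompletion v ℓ' hv).IsDeRhamFramed ((r ℓ' ι').toLocal v) ∧ (v ∉ S → (Literature.NumberTheory.PAdicHodge.fontainePstAdicCompletion v ℓ' hv).IsCrystallineFramed ((r ℓ' ι').toLocal v) ∧ letI := (Literature.NumberTheory.PAdicHodge.fontainePstAdicCompletion v ℓ' hv).algebra; ∀ τ : v.adicCompletion K →ₐ[ℚ_[ℓ']] PadicAlgCl ℓ', ∀ h ∈ (r ℓ' ι').labelledHodgeTateWeightsAt v (Literature.NumberTheory.PAdicHodge.fontainePstAdicCompletion v ℓ' hv).algebra (Literature.NumberTheory.PAdicHodge.fontainePstAdicCompletion v ℓ' hv).𝔅 τ.toRingHom,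 h ∈ I)) ∧ ∀ v : IsDedekindDomain.HeightOneSpectrum (NumberField.RingOfIntegers K), v ∉ S → ((ℓ : ℕ) : NumberField.RingOfIntegers K) ∉ v.asIdeal → ρ.IsUnramifiedAt v ∧ ρ.HasFrobCharpolyAt v ((Q v).map (ι.symm : ℂ ≃+* PadicAlgCl ℓ).toRingHom)) ∨ ∃ (N : Type) (_ : Field N) (_ : NumberField N) (_ : Algebra K N) (M : Type) (_ : Field M) (_ : NumberField M) (_ : Algebra K M) (_ : Algebra M N) (_ : IsScalarTower K M N), IsGalois K N ∧ IsSolvable (N ≃ₐ[K] N) ∧ (ρ.restrictField M).toGaloisRep.IsIrreducible ∧ ∃ (S : Finset (IsDedekindDomain.HeightOneSpectrum (NumberField.RingOfIntegers M))) (Q : IsDedekindDomain.HeightOneSpectrum (NumberField.RingOfIntegers M) → Polynomial ℂ) (I : Finset ℤ) (L : Set ℕ) (r : ∀ (ℓ' : ℕ) [Fact ℓ'.Prime], (PadicAlgCl ℓ' ≃+* ℂ) → Literature.NumberTheory.GaloisRepresentations.FramedGaloisRep M (PadicAlgCl ℓ') n), ((∃ E : Subfield ℂ, FiniteDimensional ℚ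 E ∧ ∀ v : IsDedekindDomain.HeightOneSpectrum (NumberField.RingOfIntegers M), v ∉ S → ∀ i : ℕ, (Q v).coeff i ∈ E) ∧ Literature.NumberTheory.LFunctions.HasDirichletDensity L 1 ∧ ∀ (ℓ' : ℕ) [Fact ℓ'.Prime], ℓ' ∈ L → ∀ ι' : PadicAlgCl ℓ' ≃+* ℂ, (r ℓ' ι').toGaloisRep.IsIrreducible ∧ (∀ᶠ v : IsDedekindDomain.HeightOneSpectrum (NumberField.RingOfIntegers M) in cofinite, (r ℓ' ι').IsUnramifiedAt v) ∧ (∀ v : IsDedekindDomain.HeightOneSpectrum (NumberField.RingOfIntegers M), v ∉ S → ((ℓ' : ℕ) : NumberField.RingOfIntegers M) ∉ v.asIdeal → (r ℓ' ι').IsUnramifiedAt v ∧ (r ℓ' ι').HasFrobCharpolyAt v ((Q v).map (ι'.symm : ℂ ≃+* PadicAlgCl ℓ').toRingHom)) ∧ ∀ (v : IsDedekindDomain.HeightOneSpectrum (NumberField.RingOfIntegers M)) (hv : ((ℓ' : ℕ) : NumberField.RingOfIntegers M) ∈ v.asIdeal), (Literature.NumberTheory.PAdicHodge.fontainePstAdicCompletion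 v ℓ' hv).IsDeRhamFramed ((r ℓ' ι').toLocal v) ∧ (v ∉ S → (Literature.NumberTheory.PAdicHodge.fontainePstAdicCompletion v ℓ' hv).IsCrystallineFramed ((r ℓ' ι').toLocal v) ∧ letI := (Literature.NumberTheory.PAdicHodge.fontainePstAdicCompletion v ℓ' hv).algebra; ∀ τ : v.adicCompletion M →ₐ[ℚ_[ℓ']] PadicAlgCl ℓ', ∀ h ∈ (r ℓ' ι').labelledHodgeTateWeightsAt v (Literature.NumberTheory.PAdicHodge.fontainePstAdicCompletion v ℓ' hv).algebra (Literature.NumberTheory.PAdicHodge.fontainePstAdicCompletion v ℓ' hv).𝔅 τ.toRingHom, h ∈ I)) ∧ ∀ v : IsDedekindDomain.HeightOneSpectrum (NumberField.RingOfIntegers M), v ∉ S → ((ℓ : ℕ) : NumberField.RingOfIntegers M) ∉ v.asIdeal → (ρ.restrictField M).IsUnramifiedAt v ∧ (ρ.restrictField M).HasFrobCharpolyAt v ((Q v).map (ι.symm : ℂ ≃+* PadicAlgCl ℓ).toRingHom)) ↔ Theorems.BrightMate.SolvablyMated ι ρ := Iff.rfl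
/-- The CSD item text is the tree decl `HolomorphicLimitSplit.CliffordSolvableDescent` verbatim (dedup-attach, stmt-Langlands-31695). -/
theorem csd_inline_iff : CliffordSolvableDescentInline ↔ HolomorphicLimitSplit.CliffordSolvableDescent := Iff.rfl
/-- The TRANS item text is the structured support (definitional). -/
theorem trans_inline_iff : SolvableAdequacyTransportInline ↔ SolvableAdequacyTransport := Iff.rfl
/-- The ADQ clause inserted into F† is `AdequateCyclotomicImage ρ` (definitional). -/
theorem adq_clause_iff (K : Type) [Field K] [NumberField K] (n : ℕ) (ℓ : ℕ) [Fact ℓ.Prime] (ρ : FramedGaloisRep K (PadicAlgCl ℓ) n) :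
    (∃ τ : Field.absoluteGaloisGroup (CyclotomicField ℓ K) →* Matrix.GeneralLinearGroup (Fin n) (Literature.NumberTheory.GaloisRepresentations.padicAlgClResidueField ℓ), (ρ.restrictField (CyclotomicField ℓ K)).IsReductionOf (RingHom.id (Literature.NumberTheory.GaloisRepresentations.padicAlgClResidueField ℓ)) τ ∧ Literature.NumberTheory.GaloisRepresentations.IsAbsIrreducible τ ∧ Literature.NumberTheory.GaloisRepresentations.Subgroup.IsThorneAdequate τ.range) ↔ AdequateCyclotomicImage ρ := Iff.rfl
/-- The SADQ clause inserted into F† is `SolvablyAdequateImage ρ` (definitional; the bracketed triple is `IsPerfectCore τ.range P`). -/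
theorem sadq_clause_iff (K : Type) [Field K] [NumberField K] (n : ℕ) (ℓ : ℕ) [Fact ℓ.Prime] (ρ : FramedGaloisRep K (PadicAlgCl ℓ) n) :
    (∃ τ : Field.absoluteGaloisGroup (CyclotomicField ℓ K) →* Matrix.GeneralLinearGroup (Fin n) (Literature.NumberTheory.GaloisRepresentations.padicAlgClResidueField ℓ), (ρ.restrictField (CyclotomicField ℓ K)).IsReductionOf (RingHom.id (Literature.NumberTheory.GaloisRepresentations.padicAlgClResidueField ℓ)) τ ∧ Literature.NumberTheory.GaloisRepresentations.IsAbsIrreducible τ ∧ ∃ P J : Subgroup (Matrix.GeneralLinearGroup (Fin n) (Literature.NumberTheory.GaloisRepresentations.padicAlgClResidueField ℓ)), (P ≤ τ.range ∧ ⁅P, P⁆ = P ∧ ∀ Q : Subgroup (Matrix.GeneralLinearGroup (Fin n) (Literature.NumberTheory.GaloisRepresentations.padicAlgClResidueField ℓ)), Q ≤ τ.range → ⁅Q, Q⁆ = Q → Q ≤ P) ∧ P ≤ J ∧ J ≤ τ.range ∧ Literature.NumberTheory.GaloisRepresentations.IsAbsIrreducible J.subtype ∧ Literature.NumberTheory.GaloisRepresentations.Subgroup.IsThorneAdequate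 J) ↔ SolvablyAdequateImage ρ := Iff.rfl
/-- The glue of the child route on the INLINE texts (what `childroute.glue.lean` proves against the rendered file): 11 binders, all used — the
dedup items OW / RES / BRIGHT / A† are the tree decls BY NAME (their route.json texts are the host / BrightMateBypass one-liners verbatim). -/
theorem closes_inline (h₁ : AdequateImageLiftingInline) (h₃ : NoAdequateLayerLiftingInline) (hW : SatakeAvatarExistenceInline)
    (hUp : SolvableAscentConstituentInline) (hDown : CliffordSolvableDescentInline) (hT : SolvableAdequacyTransportInline)
    (hF : SmallPrimeLiftingFrame) (hOW : OdlyzkoWorldSplit.OdlyzkoWorldAutomorphy) (hRES : OdlyzkoWorldSplit.TransOdlyzkoAutomorphy)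
    (hB : BrightMateBypass.DensityOneCyclotomicBrightness) (hA : OdlyzkoWorldSplit.IrreducibleLargePrimeLifting) : _root_.Langlands := by
  refine hF ?_
  intro K _ _ n hcpt hn ih ℓ _ ι ρ hlt hc
  refine (Classical.em _).elim (fun hAdq => h₁ K n hcpt hn ih ℓ ι ρ hlt hc hAdq) fun hAdq => ?_
  refine (Classical.em _).elim (fun hS => hT hW hUp hDown h₁ K n hcpt hn ih ℓ ι ρ hlt hc hAdq hS) fun hS => ?_
  refine (Classical.em _).elim (fun hc₂ => ?_) fun hc₂ => h₃ K n hcpt hn ih ℓ ι ρ hlt hc hAdq hS (fun h => hc₂ (Or.inl h)) fun h => hc₂ (Or.inr h)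
  exact liftTail_of_carve hOW hRES hW hA hB hUp hDown K n hcpt hn ih ℓ ι ρ hc₂
end Cells

end Summit.Langlands.Langlands.Theorems.CoreAdequacy
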